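import Mathlib.MeasureTheory.Function.Jacobian
import Mathlib.MeasureTheory.Function.JacobianOneDim
import Mathlib.MeasureTheory.Integral.Prod
import Mathlib.MeasureTheory.Measure.Lebesgue.Basic
import HarnessLib

/-!
# The Saffari–Vaughan averaging trick: additive shifts from multiplicative shifts in mean square

Topic `Literature/Analysis/FunctionSpaces`. Everything in this file is PROVED (theorems only).

For a measurable, locally bounded `R : ℝ → ℝ`, `0 < H`, `2H ≤ U`:

  `∫_U^{2U} (R(u + H) − R(u))² du ≤ 8 · sup_{1 ≤ μ ≤ 1 + 2H/U} ∫_U^{3U} (R(uμ) − R(u))² du`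

(`setIntegral_addShift_sq_le`, with the supremum expressed as a uniform hypothesis). Proof
(Saffari–Vaughan): for `λ ∈ [1 + H/U, 1 + 2H/U]`,
`(R(u+H) − R(u))² ≤ 2(R(λu) − R(u))² + 2(R(λu) − R(u+H))²`; average over `λ`, integrate over
`u ∈ [U, 2U]`, swap the integrals (Fubini on a rectangle, everything bounded), and in the second
term substitute `μ = λu/(u + H) ∈ [1, 1 + 2H/U]` for fixed `u` (Jacobian `(u+H)/u ≤ 3/2`) and then
`u' = u + H`.

## References

* B. Saffari, R. C. Vaughan, *On the fractional parts of x/n and related sequences. II*,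
  Ann. Inst. Fourier 27 (1977), no. 2, 1–30, Lemma (6.19)–(6.21) (the averaging device).
* D. A. Goldston, *On the pair correlation conjecture for zeros of the Riemann zeta-function*,
  J. reine angew. Math. 385 (1988), 24–40, §3 (same device for `ψ(x+h) − ψ(x) − h`).
-/

noncomputable section

open MeasureTheory Set Real Filter Topology

namespace Literature.Analysis.FunctionSpaces.SaffariVaughan

/-! ### One-dimensional tools -/

/-- A measurable real function bounded on `[c, d]` is integrable there. [folklore] -/
theorem integrableOn_Icc_of_bound {f : ℝ → ℝ} (hf : Measurable f) {c d M : ℝ}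
    (hM : ∀ u ∈ Icc c d, |f u| ≤ M) : IntegrableOn f (Icc c d) :=
  Measure.integrableOn_of_bounded measure_Icc_lt_top.ne hf.aestronglyMeasurable
    ((ae_restrict_iff' measurableSet_Icc).2 (ae_of_all _ fun u hu ↦ by
      rw [Real.norm_eq_abs]; exact hM u hu))

/-- Linear substitution on an interval: `∫_{[a,b]} g(λκ) dλ = κ⁻¹ ∫_{[aκ, bκ]} g(μ) dμ` (`κ > 0`,
`a ≤ b`). [folklore] -/
theorem setIntegral_Icc_comp_mul (g : ℝ → ℝ) {a b κ : ℝ} (hab : a ≤ b) (hκ : 0 < κ) :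
    ∫ t in Icc a b, g (t * κ) = κ⁻¹ * ∫ μ in Icc (a * κ) (b * κ), g μ := by
  have himg : (fun t ↦ t * κ) '' Icc a b = Icc (a * κ) (b * κ) := Set.image_mul_right_Icc hab hκ.le
  have h1 : ∫ μ in Icc (a * κ) (b * κ), g μ = ∫ t in Icc a b, |κ| • g (t * κ) := by
    rw [← himg]
    exact integral_image_eq_integral_abs_deriv_smul measurableSet_Icc
      (fun x _ ↦ ((hasDerivAt_id x).mul_const κ |>.congr_deriv (by simp)).hasDerivWithinAt)
      (fun x _ y _ hxy ↦ mul_right_cancel₀ hκ.ne' hxy) g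
  rw [h1, abs_of_pos hκ]
  simp only [smul_eq_mul]
  rw [MeasureTheory.integral_const_mul, ← mul_assoc, inv_mul_cancel₀ hκ.ne', one_mul]

/-- Translation on an interval: `∫_{[a,b]} g(t + H) dt = ∫_{[a+H, b+H]} g`. [folklore] -/
theorem setIntegral_Icc_comp_add (g : ℝ → ℝ) (a b H : ℝ) :
    ∫ t in Icc a b, g (t + H) = ∫ μ in Icc (a + H) (b + H), g μ := by
  have himg : (fun t ↦ t + H) '' Icc a b = Icc (a + H) (b + H) := Set.image_add_const_Icc H a b
  rw [← himg, integral_image_eq_integral_abs_deriv_smul measurableSet_Icc (f := fun t ↦ t + H)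
    (f' := fun _ ↦ (1 : ℝ)) (fun x _ ↦ ((hasDerivAt_id' x).add_const H).hasDerivWithinAt)
    (fun x _ y _ hxy ↦ add_right_cancel hxy) g]
  simp

/-! ### The averaging trick -/

set_option maxHeartbeats 1600000 in
/-- **Saffari–Vaughan.** Let `R : ℝ → ℝ` be measurable with `|R| ≤ B` on `[0, 4U]`, `0 < H`,
`2H ≤ U`, and suppose `∫_{[U,3U]} (R(uμ) − R(u))² du ≤ M` for every `μ ∈ [1, 1 + 2H/U]`. Then
`∫_{[U,2U]} (R(u + H) − R(u))² du ≤ 8 M`.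
[cite: SaffariVaughan1977, (6.19)–(6.21) (method)] -/
theorem setIntegral_addShift_sq_le {R : ℝ → ℝ} (hR : Measurable R) {U H B M : ℝ} (hH : 0 < H)
    (hHU : 2 * H ≤ U) (hB : ∀ u ∈ Icc 0 (6 * U), |R u| ≤ B)
    (hM : ∀ μ ∈ Icc 1 (1 + 2 * H / U), ∫ u in Icc U (3 * U), (R (u * μ) - R u) ^ 2 ≤ M) :
    ∫ u in Icc U (2 * U), (R (u + H) - R u) ^ 2 ≤ 8 * M := by
  have hU : 0 < U := by linarith
  set ℓ : ℝ := H / U with hℓ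
  have hℓ0 : 0 < ℓ := by positivity
  have hℓhalf : ℓ ≤ 1 / 2 := by rw [hℓ, div_le_iff₀ hU]; linarith
  set l1 : ℝ := 1 + ℓ with hl1
  set l2 : ℝ := 1 + 2 * ℓ with hl2
  have hl2H : 1 + 2 * H / U = l2 := by rw [hl2, hℓ]; ring
  rw [hl2H] at hM
  have hl12 : l1 ≤ l2 := by rw [hl1, hl2]; linarith
  have hl2eq : l2 - l1 = ℓ := by rw [hl1, hl2]; ring
  have hl1ge : 1 ≤ l1 := by rw [hl1]; linarith
  have hl2le : l2 ≤ 2 := by rw [hl2]; linarith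
  have hl20 : 0 ≤ l2 := by linarith
  have hM0 : 0 ≤ M := le_trans (setIntegral_nonneg measurableSet_Icc fun u _ ↦ sq_nonneg _) (hM 1 ⟨le_rfl, by linarith⟩)
  have hB0 : 0 ≤ B := le_trans (abs_nonneg _) (hB 0 ⟨le_rfl, by linarith⟩)
  -- ranges: for `0 ≤ u ≤ a` and `0 ≤ t ≤ l2 ≤ 2`, `u t ≤ 2a`
  have hprod : ∀ {u t a : ℝ}, 0 ≤ u → u ≤ a → 0 ≤ t → t ≤ l2 → u * t ≤ a * 2 := fun hu0 hua ht0 ht ↦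
    mul_le_mul hua (ht.trans hl2le) ht0 (hu0.trans hua)
  have hrange1 : ∀ u ∈ Icc U (2 * U), ∀ t ∈ Icc l1 l2, u * t ∈ Icc 0 (6 * U) := by
    intro u hu t ht
    have ht0 : 0 ≤ t := by linarith [ht.1]
    exact ⟨mul_nonneg (by linarith [hu.1]) ht0, by nlinarith [hprod (by linarith [hu.1]) hu.2 ht0 ht.2]⟩
  have hrange2 : ∀ u ∈ Icc U (2 * U), u + H ∈ Icc 0 (6 * U) := fun u hu ↦ ⟨by linarith [hu.1], by linarith [hu.2]⟩
  have hrange3 : ∀ u ∈ Icc U (2 * U), u ∈ Icc 0 (6 * U) := fun u hu ↦ ⟨by linarith [hu.1], by linarith [hu.2]⟩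
  -- the three two-variable functions
  set fA : ℝ → ℝ → ℝ := fun u t ↦ (R (u * t) - R u) ^ 2 with hfA
  set fB : ℝ → ℝ → ℝ := fun u t ↦ (R (u * t) - R (u + H)) ^ 2 with hfB
  set fC : ℝ → ℝ → ℝ := fun u μ ↦ (R ((u + H) * μ) - R (u + H)) ^ 2 with hfC
  have hmA : Measurable (Function.uncurry fA) :=
    ((hR.comp (measurable_fst.mul measurable_snd)).sub (hR.comp measurable_fst)).pow_const 2
  have hmB : Measurable (Function.uncurry fB) :=
    ((hR.comp (measurable_fst.mul measurable_snd)).sub (hR.comp (measurable_fst.add_const H))).pow_const 2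
  have hmC : Measurable (Function.uncurry fC) :=
    ((hR.comp ((measurable_fst.add_const H).mul measurable_snd)).sub
      (hR.comp (measurable_fst.add_const H))).pow_const 2
  -- bounds `≤ (2B)²`
  have hsq : ∀ x y : ℝ, |x| ≤ B → |y| ≤ B → (x - y) ^ 2 ≤ (2 * B) ^ 2 := by
    intro x y hx hy
    have : |x - y| ≤ 2 * B := by have := abs_sub x y; linarith
    have h0 := sq_abs (x - y)
    nlinarith [abs_nonneg (x - y)]
  -- integrability on the rectangles (finite measure, bounded integrands)
  set μU := (volume : Measure ℝ).restrict (Icc U (2 * U)) with hμU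
  set νL := (volume : Measure ℝ).restrict (Icc l1 l2) with hνL
  set νM := (volume : Measure ℝ).restrict (Icc 1 l2) with hνM
  haveI : IsFiniteMeasure μU := by rw [hμU]; infer_instance
  haveI : IsFiniteMeasure νL := by rw [hνL]; infer_instance
  haveI : IsFiniteMeasure νM := by rw [hνM]; infer_instance
  have hIntRect : ∀ {f : ℝ → ℝ → ℝ} {c d : ℝ}, Measurable (Function.uncurry f) →
      (∀ u ∈ Icc U (2 * U), ∀ t ∈ Icc c d, |f u t| ≤ (2 * B) ^ 2) →
      Integrable (Function.uncurry f) (μU.prod ((volume : Measure ℝ).restrict (Icc c d))) := by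
    intro f c d hmeas hbd
    haveI : IsFiniteMeasure ((volume : Measure ℝ).restrict (Icc c d)) := by infer_instance
    have huniv : (μU.prod ((volume : Measure ℝ).restrict (Icc c d))) univ ≠ ⊤ := measure_ne_top _ _
    have h := Measure.integrableOn_of_bounded (M := (2 * B) ^ 2) huniv hmeas.aestronglyMeasurable ?_
    · rwa [integrableOn_univ] at h
    · rw [Measure.restrict_univ, hμU, Measure.prod_restrict, ae_restrict_iff' (measurableSet_Icc.prod measurableSet_Icc)]
      refine ae_of_all _ fun p hp ↦ ?_
      rw [Real.norm_eq_abs]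
      exact hbd p.1 hp.1 p.2 hp.2
  have hbdA : ∀ u ∈ Icc U (2 * U), ∀ t ∈ Icc l1 l2, |fA u t| ≤ (2 * B) ^ 2 := by
    intro u hu t ht
    rw [hfA]; dsimp only; rw [abs_of_nonneg (sq_nonneg _)]
    exact hsq _ _ (hB _ (hrange1 u hu t ht)) (hB _ (hrange3 u hu))
  have hbdB : ∀ u ∈ Icc U (2 * U), ∀ t ∈ Icc l1 l2, |fB u t| ≤ (2 * B) ^ 2 := by
    intro u hu t ht
    rw [hfB]; dsimp only; rw [abs_of_nonneg (sq_nonneg _)]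
    exact hsq _ _ (hB _ (hrange1 u hu t ht)) (hB _ (hrange2 u hu))
  have hbdC : ∀ u ∈ Icc U (2 * U), ∀ t ∈ Icc 1 l2, |fC u t| ≤ (2 * B) ^ 2 := by
    intro u hu t ht
    rw [hfC]; dsimp only; rw [abs_of_nonneg (sq_nonneg _)]
    have ht0 : 0 ≤ t := by linarith [ht.1]
    refine hsq _ _ (hB _ ⟨mul_nonneg (by linarith [hu.1]) ht0, ?_⟩) (hB _ (hrange2 u hu))
    nlinarith [hprod (u := u + H) (a := 3 * U) (by linarith [hu.1]) (by linarith [hu.2]) ht0 ht.2]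
  have hIA := hIntRect hmA hbdA
  have hIB := hIntRect hmB hbdB
  have hIC := hIntRect hmC hbdC
  -- Step 1–2: pointwise and λ-average
  have hstep12 : ∀ u ∈ Icc U (2 * U), ℓ * (R (u + H) - R u) ^ 2 ≤
      2 * (∫ t in Icc l1 l2, fA u t) + 2 * ∫ t in Icc l1 l2, fB u t := by
    intro u hu
    have hpt : ∀ t ∈ Icc l1 l2, (R (u + H) - R u) ^ 2 ≤ 2 * fA u t + 2 * fB u t := by
      intro t _
      rw [hfA, hfB]; dsimp only
      nlinarith [sq_nonneg ((R (u * t) - R u) + (R (u * t) - R (u + H)))]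
    have hIAu : IntegrableOn (fun t ↦ fA u t) (Icc l1 l2) :=
      integrableOn_Icc_of_bound (hmA.comp (measurable_const.prodMk measurable_id)) (hbdA u hu)
    have hIBu : IntegrableOn (fun t ↦ fB u t) (Icc l1 l2) :=
      integrableOn_Icc_of_bound (hmB.comp (measurable_const.prodMk measurable_id)) (hbdB u hu)
    have hvol : volume.real (Icc l1 l2) = ℓ := by
      rw [Measure.real, Real.volume_Icc, ENNReal.toReal_ofReal (by linarith), hl2eq]
    calc ℓ * (R (u + H) - R u) ^ 2 = ∫ _ in Icc l1 l2, (R (u + H) - R u) ^ 2 := by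
          rw [setIntegral_const, hvol, smul_eq_mul]
      _ ≤ ∫ t in Icc l1 l2, (2 * fA u t + 2 * fB u t) :=
          setIntegral_mono_on (integrableOn_const (hs := measure_Icc_lt_top.ne))
            ((hIAu.const_mul 2).add (hIBu.const_mul 2)) measurableSet_Icc hpt
      _ = _ := by
          rw [integral_add (hIAu.const_mul 2) (hIBu.const_mul 2), MeasureTheory.integral_const_mul,
            MeasureTheory.integral_const_mul]
  -- Step 3: for fixed `u`, `∫_λ fB ≤ (3/2) ∫_{μ ∈ [1, l2]} fC`
  have hstep3 : ∀ u ∈ Icc U (2 * U), ∫ t in Icc l1 l2, fB u t ≤ 3 / 2 * ∫ μ in Icc 1 l2, fC u μ := by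
    intro u hu
    have hu0 : 0 < u := by linarith [hu.1]
    set κ : ℝ := u / (u + H) with hκ
    have hκ0 : 0 < κ := by positivity
    have hκinv : κ⁻¹ ≤ 3 / 2 := by
      rw [hκ, inv_div, div_le_iff₀ hu0]; nlinarith [hu.1]
    have hκinv0 : 0 ≤ κ⁻¹ := by positivity
    -- `fB u t = fC u (t κ)`
    have heq : ∀ t, fB u t = fC u (t * κ) := by
      intro t
      rw [hfB, hfC]; dsimp only
      rw [show (u + H) * (t * (u / (u + H))) = u * t by field_simp]
    have h1 : ∫ t in Icc l1 l2, fB u t = κ⁻¹ * ∫ μ in Icc (l1 * κ) (l2 * κ), fC u μ := by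
      rw [show (fun t ↦ fB u t) = fun t ↦ fC u (t * κ) from funext heq]
      exact setIntegral_Icc_comp_mul (fC u) hl12 hκ0
    have hsub : Icc (l1 * κ) (l2 * κ) ⊆ Icc 1 l2 := by
      refine Icc_subset_Icc ?_ ?_
      · rw [hκ, hl1, mul_div_assoc', le_div_iff₀ (by positivity), one_mul, add_mul, one_mul,
          add_le_add_iff_left, hℓ, div_mul_eq_mul_div, le_div_iff₀ hU]
        nlinarith [hu.1]
      · have : κ ≤ 1 := by rw [hκ, div_le_one (by positivity)]; linarith
        nlinarith [show 0 ≤ l2 by linarith]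
    have hICu : IntegrableOn (fun μ ↦ fC u μ) (Icc 1 l2) :=
      integrableOn_Icc_of_bound (hmC.comp (measurable_const.prodMk measurable_id)) (hbdC u hu)
    have h2 : ∫ μ in Icc (l1 * κ) (l2 * κ), fC u μ ≤ ∫ μ in Icc 1 l2, fC u μ :=
      setIntegral_mono_set hICu ((ae_restrict_iff' measurableSet_Icc).2 (ae_of_all _ fun μ _ ↦ sq_nonneg _))
        (Eventually.of_forall hsub)
    have h3 : 0 ≤ ∫ μ in Icc 1 l2, fC u μ := setIntegral_nonneg measurableSet_Icc fun μ _ ↦ sq_nonneg _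
    rw [h1]
    calc κ⁻¹ * ∫ μ in Icc (l1 * κ) (l2 * κ), fC u μ ≤ κ⁻¹ * ∫ μ in Icc 1 l2, fC u μ :=
          mul_le_mul_of_nonneg_left h2 hκinv0
      _ ≤ 3 / 2 * ∫ μ in Icc 1 l2, fC u μ := mul_le_mul_of_nonneg_right hκinv h3
  -- Step 4: integrate over `u`
  have hIA1 : Integrable (fun u ↦ ∫ t in Icc l1 l2, fA u t) μU := hIA.integral_prod_left
  have hIB1 : Integrable (fun u ↦ ∫ t in Icc l1 l2, fB u t) μU := hIB.integral_prod_left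
  have hIC1 : Integrable (fun u ↦ ∫ μ in Icc 1 l2, fC u μ) μU := hIC.integral_prod_left
  have hID : IntegrableOn (fun u ↦ (R (u + H) - R u) ^ 2) (Icc U (2 * U)) :=
    integrableOn_Icc_of_bound (((hR.comp (measurable_id.add_const H)).sub hR).pow_const 2) fun u hu ↦ by
      rw [abs_of_nonneg (sq_nonneg _)]; exact hsq _ _ (hB _ (hrange2 u hu)) (hB _ (hrange3 u hu))
  have hstep4 : ℓ * ∫ u in Icc U (2 * U), (R (u + H) - R u) ^ 2 ≤
      2 * (∫ u in Icc U (2 * U), ∫ t in Icc l1 l2, fA u t) +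
        3 * ∫ u in Icc U (2 * U), ∫ μ in Icc 1 l2, fC u μ := by
    rw [← MeasureTheory.integral_const_mul]
    have hpt : ∀ u ∈ Icc U (2 * U), ℓ * (R (u + H) - R u) ^ 2 ≤
        2 * (∫ t in Icc l1 l2, fA u t) + 3 * ∫ μ in Icc 1 l2, fC u μ := by
      intro u hu
      have := hstep12 u hu
      have h3 := hstep3 u hu
      linarith
    calc ∫ u in Icc U (2 * U), ℓ * (R (u + H) - R u) ^ 2
        ≤ ∫ u in Icc U (2 * U), (2 * (∫ t in Icc l1 l2, fA u t) + 3 * ∫ μ in Icc 1 l2, fC u μ) :=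
          setIntegral_mono_on (hID.const_mul ℓ) ((hIA1.const_mul 2).add (hIC1.const_mul 3)) measurableSet_Icc hpt
      _ = _ := by
          rw [integral_add (hIA1.const_mul 2) (hIC1.const_mul 3), MeasureTheory.integral_const_mul,
            MeasureTheory.integral_const_mul]
  -- Step 5a: swap and bound the `fA` term by `ℓ M`
  have h5a : ∫ u in Icc U (2 * U), ∫ t in Icc l1 l2, fA u t ≤ ℓ * M := by
    have hswap : ∫ u in Icc U (2 * U), ∫ t in Icc l1 l2, fA u t = ∫ t in Icc l1 l2, ∫ u in Icc U (2 * U), fA u t :=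
      integral_integral_swap hIA
    rw [hswap]
    have hinner : ∀ t ∈ Icc l1 l2, ∫ u in Icc U (2 * U), fA u t ≤ M := by
      intro t ht
      have htM : t ∈ Icc 1 l2 := ⟨hl1ge.trans ht.1, ht.2⟩
      have hIt : IntegrableOn (fun u ↦ fA u t) (Icc U (3 * U)) := by
        refine integrableOn_Icc_of_bound (hmA.comp (measurable_id.prodMk measurable_const)) (M := (2 * B) ^ 2)
          fun u hu ↦ ?_
        show |fA u t| ≤ (2 * B) ^ 2
        rw [hfA, abs_of_nonneg (sq_nonneg _)]
        have ht0 : 0 ≤ t := by linarith [ht.1]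
        refine hsq _ _ (hB _ ⟨mul_nonneg (by linarith [hu.1]) ht0, ?_⟩) (hB _ ⟨by linarith [hu.1], by linarith [hu.2]⟩)
        nlinarith [hprod (a := 3 * U) (by linarith [hu.1]) hu.2 ht0 ht.2]
      calc ∫ u in Icc U (2 * U), fA u t ≤ ∫ u in Icc U (3 * U), fA u t :=
            setIntegral_mono_set hIt ((ae_restrict_iff' measurableSet_Icc).2 (ae_of_all _ fun u _ ↦ sq_nonneg _))
              (Eventually.of_forall (Icc_subset_Icc le_rfl (by linarith)))
        _ ≤ M := hM t htM
    have hvol : volume.real (Icc l1 l2) = ℓ := by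
      rw [Measure.real, Real.volume_Icc, ENNReal.toReal_ofReal (by linarith), hl2eq]
    calc ∫ t in Icc l1 l2, ∫ u in Icc U (2 * U), fA u t ≤ ∫ t in Icc l1 l2, M :=
          setIntegral_mono_on hIA.swap.integral_prod_left (integrableOn_const (hs := measure_Icc_lt_top.ne))
            measurableSet_Icc hinner
      _ = ℓ * M := by rw [setIntegral_const, hvol, smul_eq_mul]
  -- Step 5b: swap, translate and bound the `fC` term by `2 ℓ M`
  have h5b : ∫ u in Icc U (2 * U), ∫ μ in Icc 1 l2, fC u μ ≤ 2 * ℓ * M := by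
    have hswap : ∫ u in Icc U (2 * U), ∫ μ in Icc 1 l2, fC u μ = ∫ μ in Icc 1 l2, ∫ u in Icc U (2 * U), fC u μ :=
      integral_integral_swap hIC
    rw [hswap]
    have hinner : ∀ μ ∈ Icc 1 l2, ∫ u in Icc U (2 * U), fC u μ ≤ M := by
      intro μ hμ
      have htr : ∫ u in Icc U (2 * U), fC u μ = ∫ u in Icc (U + H) (2 * U + H), fA u μ := by
        rw [hfC, hfA]
        exact setIntegral_Icc_comp_add (fun u ↦ (R (u * μ) - R u) ^ 2) U (2 * U) H
      have hIt : IntegrableOn (fun u ↦ fA u μ) (Icc U (3 * U)) := by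
        refine integrableOn_Icc_of_bound (hmA.comp (measurable_id.prodMk measurable_const)) (M := (2 * B) ^ 2)
          fun u hu ↦ ?_
        show |fA u μ| ≤ (2 * B) ^ 2
        rw [hfA, abs_of_nonneg (sq_nonneg _)]
        have hμ0 : 0 ≤ μ := by linarith [hμ.1]
        refine hsq _ _ (hB _ ⟨mul_nonneg (by linarith [hu.1]) hμ0, ?_⟩) (hB _ ⟨by linarith [hu.1], by linarith [hu.2]⟩)
        nlinarith [hprod (a := 3 * U) (by linarith [hu.1]) hu.2 hμ0 hμ.2]
      rw [htr]
      calc ∫ u in Icc (U + H) (2 * U + H), fA u μ ≤ ∫ u in Icc U (3 * U), fA u μ :=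
            setIntegral_mono_set hIt ((ae_restrict_iff' measurableSet_Icc).2 (ae_of_all _ fun u _ ↦ sq_nonneg _))
              (Eventually.of_forall (Icc_subset_Icc (by linarith) (by linarith)))
        _ ≤ M := hM μ hμ
    have hvol : volume.real (Icc 1 l2) = 2 * ℓ := by
      rw [Measure.real, Real.volume_Icc, ENNReal.toReal_ofReal (by linarith), hl2]; ring
    calc ∫ μ in Icc 1 l2, ∫ u in Icc U (2 * U), fC u μ ≤ ∫ μ in Icc 1 l2, M :=
          setIntegral_mono_on hIC.swap.integral_prod_left (integrableOn_const (hs := measure_Icc_lt_top.ne))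
            measurableSet_Icc hinner
      _ = 2 * ℓ * M := by rw [setIntegral_const, hvol, smul_eq_mul]
  -- conclusion
  have hfinal : ℓ * ∫ u in Icc U (2 * U), (R (u + H) - R u) ^ 2 ≤ ℓ * (8 * M) := by
    have := hstep4
    nlinarith [h5a, h5b]
  exact le_of_mul_le_mul_left hfinal hℓ0

end Literature.Analysis.FunctionSpaces.SaffariVaughan

end
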